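import Summits.QuantumFields.YangMills.Theorems.LuscherReductionTwistedTraceScalingBTSchedule
import HarnessLib

/-!
# R40 — STIFF CAPTURE NECESSITY for bricks (B-T)/(B-ST)/(B-OD) of `RecordAnalyticInput`: the stiff gap bounds the UN-CAPTURED MASS of every near-top tube state,
# `θ₀·‖h − P_Ω h‖²_w ≤ (2κ + η + b)·‖h‖²_w`, so the BO profile `Ω` of record must capture the top of the tube to `1 − o(1)`; the flat, log-free profile `btOmega` cannot
(crux `LuscherReduction.TwistedTraceScaling`, stmt-QuantumFields-20203, skeleton «twolattice» rev 3, stub S-BASE, sub-target C4-CORE; standing disprover, cycle 33;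
`Cruxes/TwistedTraceScaling/Disproof.lean` §AL / VERDICT 33, Annex B §V1l; vets lane A g14's p668960 `…BTSchedule` (`btOmega`, `btRad`) against the `hST` field of p652422)

Lane A's hand-off object `RecordAnalyticInput L s M` (p652422) posits ONE fibre profile `Ω` and numbers `σ > 0, κ → 0, b → 0, θ₀ > 0` with
(B-T) `hT : tubeForm(boFun φ Ω) = σγ·qform(φ,φ)·(1 ± κ(…))`, (B-ST) `hST : tubeForm v ≤ (1−θ₀)σλ₀‖v‖²_w` for every admissible `v` FIBREWISE `w`-orthogonal to `Ω`
(`fibreInner w Ω v ≡ 0`), and (B-OD) `hOD : |tubeCross(boFun φ Ω, v)| ≤ bσλ₀‖boFun φ Ω‖_w‖v‖_w` (both orders).  Feshbach algebra turns the three into an UPPER bound on the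
whole tube (lane A's `feshbach_endgame`, assembly (G)).  This file records the converse bookkeeping — a NECESSARY CONDITION on `Ω`, independent of how the bricks are proved.

* §1 ★★ `stiff_capture` — scalar Rayleigh data of an admissible `h = p + v`, `p = P_Ω h` (`boProj`), `v = h − p` (fibrewise `w`-orthogonal to `Ω`, `fibreInner_sub_boProj`),
  masses `Nu = ‖p‖²_w`, `Nv = ‖v‖²_w` (`tubeNormSq_boProj_add`: `Nu + Nv = ‖h‖²_w`), `Q = T(h) = T(p) + X(p,v) + X(v,p) + T(v)` (`tubeForm_add`): if `h` is `(1−η)`-near the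
  top `μ` of the tube form on admissible states, `μ ≥ (1−κ)ρ` (the BO state on the top one-site mode reaches it, by the lower half of (B-T); `ρ = σλ₀`),
  `T(p) ≤ (1+κ)ρNu` ((B-T) upper half + (B-N)), `T(v) ≤ (1−θ)ρNv` ((B-ST)), `|X(p,v)|, |X(v,p)| ≤ bρ√Nu√Nv` ((B-OD)), then **`θ·Nv ≤ (2κ + η + 2b)·(Nu + Nv)`**.
  ★ `stiff_gap_le_of_uncaptured`: an un-captured fraction `Nv ≥ c(Nu+Nv)` forces `θc ≤ 2κ + η + 2b`; ★★ `stiff_gap_nonpos_of_tendsto`: along any filter with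
  `κ, η, b → 0`, a FIXED un-captured fraction `c > 0` of near-top states forces `θ ≤ 0` — (B-ST) with a fixed `θ₀ > 0` is then unsatisfiable for that `Ω`,
  WHATEVER `σ, κ, b` are (`no_stiff_gap_of_uncaptured`).
* §2 ★ `sq_integral_mul_le_of_support` / `fibreInner_sq_le` — the capture is bounded by the mass on the support, fibre by fibre (weighted Cauchy–Schwarz on
  `(orthoTransverse, w ≥ 0)`): `fibreInner w Ω f u ² ≤ fibreMass w Ω u · ∫ 𝟙_S(linkEmbed v)·f(orthoTube u v)²·w dπ(v)` whenever `Ω = 0` off `S`; hence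
  (`fibre_capture_le`, `fibre_capture_le_ball`) the BO mass `fibreInner²/fibreMass` that `boProj` extracts from `f` in the fibre over `u` is at most the `w`-mass of `f`
  on `{relLinkVec ∈ S}` in that fibre: **a profile supported in `{‖x‖ ≤ r}` (field `hΩr`) captures at most the mass of the state inside that fibre ball.**
* §3 ★★ `record_capture_le_ball` — the same in the record's own currency: for ANY `A : RecordAnalyticInput L s M` and every `β`, the BO projection on `A.Ω β` with the record
  weight `softWeight (recordChi L s 43 M β)` captures at most the mass on `{‖relLinkVec‖ ≤ A.r β}` (fields `hΩm, hΩ1, hΩr` only); ★★ `btOmega_capture_le_ball` — lane A's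
  `btOmega` (p668960) captures at most the mass on `{‖relLinkVec‖ ≤ β^{-1/2}}`, for every weight.

READING for lane A (paper; numbers from the Born–Oppenheimer fibre model of record at `L = 2`, scaled fibre coordinate `y = β^{1/2}x`, kernel `e^{−|y−y'|²}e^{−(Q(y)+Q(y'))/2}`,
`Q = Σ ω_k² y_k²/…` with the transverse non-zero-momentum frequencies `ω² ∈ {4, 8, 12}` of multiplicities `18, 18, 6` (`D = 6L³ − 6 = 42` physical fast modes), Mehler ground
amplitude `Π e^{−b_k y_k²}`, `b_k = √(a_k² + 2a_k)`, `a_k = ω_k²/2`; see Disproof.lean VERDICT 33 and Annex B §V1l for the derivation and the scripts):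
(i) `…BTSchedule.btOmega L = frozenProfile L 0 btRad`, `btRad β = min (1/40) β^{-1/2}`: support `‖x‖ ≤ β^{-1/2}`, i.e. `|y| ≤ 1`, FLAT in the physical directions.  The model
ground state has `⟨|y|²⟩ = Σ 1/(4b_k) = 2.73`, median radius `1.64`, and mass `≤ e^{−7.3}` inside `|y| ≤ 1` (Chernoff `inf_λ e^{λ}Π(1 + λ/(2b_k))^{−1/2}`; Monte Carlo `1.0·10⁻⁴`).
By §2 the capture of ANY profile supported in `|y| ≤ 1` is `≤ 10⁻⁴` per fibre, so by §1 `θ₀·(1 − 10⁻⁴) ≤ 2κ + η + 2b → 0`: (B-ST) FAILS for `btOmega` for every `θ₀ > 0`, whatever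
`σ, κ, b` — typed target `¬ ∃ A : RecordAnalyticInput L s M, A.Ω = btOmega L` (Disproof §AL; the only non-formal link is the identification of the near-top tube states with
the Mehler state at leading order, i.e. the content of Lüscher's §3 itself, which the route presupposes).
(ii) FLATNESS ALONE is fatal at every radius: the capture `(∫_{B_R} g)²/vol(B_R)` of a flat fibre ball against the unit Mehler amplitude `g` peaks at `R ≈ 1.7` with value `0.17`
(importance-sampled, 2·10⁵ samples; `R = 1.0: 1.0·10⁻⁴, 1.4: 0.059, 1.6: 0.164, 1.7: 0.174, 1.8: 0.145, 2.0: 0.050, 2.2: 0.008`; best product box `0.0075 = 0.890^{42}`):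
an un-captured fraction `c ≥ 0.82`, so `θ₀ ≤ (2κ + η + 2b)/0.82 → 0`.
(iii) WHAT SURVIVES: `Ω` must track the true fibre ground state with vanishing `w`-angle — the Mehler/Riccati Gaussian `q(x) = β·Σ b_k x_k²` in transverse normal modes (as
`…BTFibreProfile` anticipates: «(B-ST) will fix `q` as the stiff Mehler/Riccati ground form») — AND a support radius whose lost mass is `o(1)`: `r·β^{1/2} → ∞`
(`r = 2.1β^{-1/2}` still loses 1 %; `r = c₀β^{-1/2}(D + log β)^{1/2}` loses `O(β^{-c})`), growing like `L^{3/2}` (`⟨|y|²⟩ ≈ 0.065·D`: median radius `3.28` at `L = 3` (`D = 156`),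
`5.21` at `L = 4` (`D = 378`)).  The (B-T) rate schedule (`…BTRates`, `…BTRatesAtoms`) must be re-run for THAT support and Gaussian (floor/tail competition at `r²β ~ log β`,
disprover ADDENDA 32b–32d); the (B-T) engines (`recordBT_hT_of_eventually`, p668960) are profile-agnostic and stay valid — they are correct statements about a profile the record
cannot use.  Nothing here refutes a landed file.
HONEST FRAMING: scalar Feshbach algebra and one weighted Cauchy–Schwarz inequality about a stub (S-BASE, C4-CORE) of a child of the CONDITIONAL reduction route R2b1 (bears on R2b1
only); not `¬TwistedTraceScaling`, not infinite volume, not a gap, not Clay.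

## References
* J. Sjöstrand, M. Zworski, *Elementary linear algebra for advanced spectral problems*, Ann. Inst. Fourier 57 (2007) 2095–2141, §2 (Schur complement / Grushin problem). [SjostrandZworski2007]
* M. Lüscher, *Some analytic results concerning the mass spectrum of Yang–Mills gauge theories on a torus*, Nucl. Phys. B219 (1983) 233–261, §3. [Luscher1983]
-/

set_option autoImplicit false

noncomputable section

open MeasureTheory Real Filter Topology
open scoped BigOperators
open Literature.MathematicalPhysics.QuantumFieldTheory hiding SU2
open Literature.MathematicalPhysics.QuantumLattice

namespace Summit.QuantumFields.YangMills.Theorems.TwistedTraceScaling.Negative.R40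

open Summit.QuantumFields.YangMills.Theorems.FemtoTransferGap
open Summit.QuantumFields.YangMills.Theorems.FemtoTransferGap.TwoLattice.ConstTube
open Summit.QuantumFields.YangMills.Theorems.FemtoTransferGap.TwoLattice.Stiff (LinkSpace)

/-! ## §1 Scalar Feshbach necessity: the stiff gap bounds the un-captured mass -/

/-- `2√x√y ≤ x + y` (AM–GM). [folklore] -/
theorem two_mul_sqrt_mul_sqrt_le {x y : ℝ} (hx : 0 ≤ x) (hy : 0 ≤ y) : 2 * (Real.sqrt x * Real.sqrt y) ≤ x + y := by
  nlinarith [sq_nonneg (Real.sqrt x - Real.sqrt y), Real.sq_sqrt hx, Real.sq_sqrt hy]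

/-- ★★ **STIFF CAPTURE.**  Scalar Rayleigh data of a near-top state `h = p + v` of a quadratic form `T` with top `μ`, split into its BO part `p` (mass `Nu`, `T(p) = Quu`) and its
fibrewise-orthogonal remainder `v` (mass `Nv`, `T(v) = Qvv`), cross terms `X₁ = X(p,v)`, `X₂ = X(v,p)`:
(TOP) `(1−η)μ(Nu+Nv) ≤ Q ≤ Quu + X₁ + X₂ + Qvv`, (LEVEL) `(1−κ)ρ ≤ μ`, (B-T) `Quu ≤ (1+κ)ρNu`, (B-ST) `Qvv ≤ (1−θ)ρNv`, (B-OD) `|Xᵢ| ≤ bρ√Nu√Nv`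
⟹ **`θ·Nv ≤ (2κ + η + 2b)·(Nu + Nv)`**: the stiff gap controls the un-captured mass. [cite: SjostrandZworski2007, §2] -/
theorem stiff_capture {Q Quu Qvv X₁ X₂ Nu Nv ρ μ θ κ η b : ℝ} (hρ : 0 < ρ) (hNu : 0 ≤ Nu) (hNv : 0 ≤ Nv) (hκ : 0 ≤ κ) (hη : 0 ≤ η) (hη1 : η ≤ 1) (hb : 0 ≤ b)
    (hQ : Q ≤ Quu + X₁ + X₂ + Qvv) (htop : (1 - η) * μ * (Nu + Nv) ≤ Q) (hμ : (1 - κ) * ρ ≤ μ)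
    (huu : Quu ≤ (1 + κ) * ρ * Nu) (hvv : Qvv ≤ (1 - θ) * ρ * Nv)
    (hX₁ : |X₁| ≤ b * ρ * (Real.sqrt Nu * Real.sqrt Nv)) (hX₂ : |X₂| ≤ b * ρ * (Real.sqrt Nu * Real.sqrt Nv)) :
    θ * Nv ≤ (2 * κ + η + 2 * b) * (Nu + Nv) := by
  have hN : 0 ≤ Nu + Nv := add_nonneg hNu hNv
  -- (LEVEL) × (TOP): `(1−η)(1−κ)ρ(Nu+Nv) ≤ Q`
  have h1 : (1 - η) * ((1 - κ) * ρ) * (Nu + Nv) ≤ (1 - η) * μ * (Nu + Nv) :=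
    mul_le_mul_of_nonneg_right (mul_le_mul_of_nonneg_left hμ (by linarith)) hN
  -- (B-OD) with `2√Nu√Nv ≤ Nu + Nv`: `X₁ + X₂ ≤ bρ(Nu+Nv)`
  have hbρ : 0 ≤ b * ρ := mul_nonneg hb hρ.le
  have hs := mul_le_mul_of_nonneg_left (two_mul_sqrt_mul_sqrt_le hNu hNv) hbρ
  have hX : X₁ + X₂ ≤ b * ρ * (Nu + Nv) := by linarith [(abs_le.mp hX₁).2, (abs_le.mp hX₂).2]
  -- assemble `θρNv ≤ (2κ+η+2b)ρ(Nu+Nv)` and cancel `ρ > 0`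
  have hmain : θ * Nv * ρ ≤ (2 * κ + η + 2 * b) * (Nu + Nv) * ρ := by
    have p1 : 0 ≤ κ * ρ * Nv := mul_nonneg (mul_nonneg hκ hρ.le) hNv
    have p2 : 0 ≤ η * κ * ρ * (Nu + Nv) := mul_nonneg (mul_nonneg (mul_nonneg hη hκ) hρ.le) hN
    nlinarith
  exact le_of_mul_le_mul_right hmain hρ

/-- ★ **An un-captured fraction bounds the stiff gap**: with the data of `stiff_capture`, `0 < Nu + Nv`, `0 ≤ c` and `c·(Nu + Nv) ≤ Nv` give `θ·c ≤ 2κ + η + 2b`.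
[cite: SjostrandZworski2007, §2] -/
theorem stiff_gap_le_of_uncaptured {Q Quu Qvv X₁ X₂ Nu Nv ρ μ θ κ η b c : ℝ} (hρ : 0 < ρ) (hNu : 0 ≤ Nu) (hNv : 0 ≤ Nv) (hκ : 0 ≤ κ) (hη : 0 ≤ η) (hη1 : η ≤ 1)
    (hb : 0 ≤ b) (hQ : Q ≤ Quu + X₁ + X₂ + Qvv) (htop : (1 - η) * μ * (Nu + Nv) ≤ Q) (hμ : (1 - κ) * ρ ≤ μ)
    (huu : Quu ≤ (1 + κ) * ρ * Nu) (hvv : Qvv ≤ (1 - θ) * ρ * Nv)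
    (hX₁ : |X₁| ≤ b * ρ * (Real.sqrt Nu * Real.sqrt Nv)) (hX₂ : |X₂| ≤ b * ρ * (Real.sqrt Nu * Real.sqrt Nv))
    (hN : 0 < Nu + Nv) (hc0 : 0 ≤ c) (hc : c * (Nu + Nv) ≤ Nv) : θ * c ≤ 2 * κ + η + 2 * b := by
  have hcap := stiff_capture hρ hNu hNv hκ hη hη1 hb hQ htop hμ huu hvv hX₁ hX₂
  rcases le_or_gt 0 θ with hθ | hθ
  · have h2 : θ * c * (Nu + Nv) ≤ (2 * κ + η + 2 * b) * (Nu + Nv) := by nlinarith [mul_le_mul_of_nonneg_left hc hθ]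
    exact le_of_mul_le_mul_right h2 hN
  · have : θ * c ≤ 0 := mul_nonpos_iff.mpr (Or.inr ⟨hθ.le, hc0⟩)
    linarith

/-- ★★ **No fixed stiff gap survives a fixed un-captured fraction**: if along a filter the brick constants `κ, η, b → 0` while `θ·c ≤ 2κ + η + 2b` eventually (the output of
`stiff_gap_le_of_uncaptured` for a family of near-top states keeping the un-captured fraction `c > 0`), then `θ ≤ 0`. [cite: SjostrandZworski2007, §2] -/
theorem stiff_gap_nonpos_of_tendsto {ι : Type*} {l : Filter ι} [l.NeBot] {θ c : ℝ} (hc : 0 < c) {κ η b : ι → ℝ}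
    (hκ : Tendsto κ l (𝓝 0)) (hη : Tendsto η l (𝓝 0)) (hb : Tendsto b l (𝓝 0)) (h : ∀ᶠ i in l, θ * c ≤ 2 * κ i + η i + 2 * b i) : θ ≤ 0 := by
  have hlim : Tendsto (fun i => 2 * κ i + η i + 2 * b i) l (𝓝 (2 * 0 + 0 + 2 * 0)) := ((hκ.const_mul 2).add hη).add (hb.const_mul 2)
  have hle : θ * c ≤ 2 * 0 + 0 + 2 * 0 := le_of_tendsto_of_tendsto tendsto_const_nhds hlim h
  nlinarith

/-- ★★ **NECESSITY OF CAPTURE (packaged).**  Suppose that along a filter `l` (think `β → ∞`) the brick constants satisfy `κ, η, b → 0`, and that eventually there are scalar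
Rayleigh data as in `stiff_capture` — a near-top state split along `Ω` — whose un-captured fraction is at least a FIXED `c > 0`.  Then the stiff constant `θ` is `≤ 0`: a
(B-ST) brick with `θ₀ > 0` is impossible for that profile, whatever `σ, κ, b` are. [cite: SjostrandZworski2007, §2] [cite: Luscher1983, §3] -/
theorem no_stiff_gap_of_uncaptured {ι : Type*} {l : Filter ι} [l.NeBot] {θ c : ℝ} (hθ : 0 < θ) (hc : 0 < c) {κ η b : ι → ℝ}
    (hκ : Tendsto κ l (𝓝 0)) (hη : Tendsto η l (𝓝 0)) (hb : Tendsto b l (𝓝 0))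
    (hdata : ∀ᶠ i in l, ∃ Q Quu Qvv X₁ X₂ Nu Nv ρ μ : ℝ, 0 < ρ ∧ 0 ≤ Nu ∧ 0 ≤ Nv ∧ 0 ≤ κ i ∧ 0 ≤ η i ∧ η i ≤ 1 ∧ 0 ≤ b i ∧
      Q ≤ Quu + X₁ + X₂ + Qvv ∧ (1 - η i) * μ * (Nu + Nv) ≤ Q ∧ (1 - κ i) * ρ ≤ μ ∧ Quu ≤ (1 + κ i) * ρ * Nu ∧ Qvv ≤ (1 - θ) * ρ * Nv ∧
      |X₁| ≤ b i * ρ * (Real.sqrt Nu * Real.sqrt Nv) ∧ |X₂| ≤ b i * ρ * (Real.sqrt Nu * Real.sqrt Nv) ∧ 0 < Nu + Nv ∧ c * (Nu + Nv) ≤ Nv) : False := by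
  have hev : ∀ᶠ i in l, θ * c ≤ 2 * κ i + η i + 2 * b i := by
    filter_upwards [hdata] with i hi
    obtain ⟨Q, Quu, Qvv, X₁, X₂, Nu, Nv, ρ, μ, hρ, hNu, hNv, hκi, hηi, hη1, hbi, hQ, htop, hμ, huu, hvv, hX₁, hX₂, hN, hcN⟩ := hi
    exact stiff_gap_le_of_uncaptured hρ hNu hNv hκi hηi hη1 hbi hQ htop hμ huu hvv hX₁ hX₂ hN hc.le hcN
  have := stiff_gap_nonpos_of_tendsto hc hκ hη hb hev
  linarith

/-! ## §2 The capture is bounded by the mass on the support (weighted Cauchy–Schwarz, fibre by fibre) -/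

/-- **Weighted Cauchy–Schwarz on a support set.**  On a finite measure space, for bounded measurable `p, q`, a bounded measurable weight `ω ≥ 0` and a measurable
`{0,1}`-valued `χ` with `χ = 1` wherever `p ≠ 0`: `(∫ q·p·ω)² ≤ (∫ p²·ω)·(∫ χ·q²·ω)`. [folklore] -/
theorem sq_integral_mul_le_of_support {X : Type*} [MeasurableSpace X] (μ : Measure X) [IsFiniteMeasure μ] {p q ω χ : X → ℝ}
    (hp : Measurable p) (hq : Measurable q) (hω : Measurable ω) (hχ : Measurable χ) {Cp Cq Cω : ℝ} (hCp : ∀ x, |p x| ≤ Cp) (hCq : ∀ x, |q x| ≤ Cq)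
    (hCω : ∀ x, |ω x| ≤ Cω) (hω0 : ∀ x, 0 ≤ ω x) (hχ01 : ∀ x, χ x = 0 ∨ χ x = 1) (hχp : ∀ x, p x ≠ 0 → χ x = 1) :
    (∫ x, q x * p x * ω x ∂μ) ^ 2 ≤ (∫ x, p x ^ 2 * ω x ∂μ) * ∫ x, χ x * q x ^ 2 * ω x ∂μ := by
  -- integrability of the three bounded integrands
  have iA : Integrable (fun x => p x ^ 2 * ω x) μ :=
    integrable_of_measurable_abs_le μ ((hp.pow_const 2).mul hω) (C := Cp ^ 2 * Cω) fun x => by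
      have hp0 : 0 ≤ Cp := (abs_nonneg _).trans (hCp x)
      rw [abs_mul, abs_pow]
      exact mul_le_mul (pow_le_pow_left₀ (abs_nonneg _) (hCp x) 2) (hCω x) (abs_nonneg _) (pow_nonneg hp0 2)
  have iB : Integrable (fun x => q x * p x * ω x) μ :=
    integrable_of_measurable_abs_le μ ((hq.mul hp).mul hω) (C := Cq * Cp * Cω) fun x => by
      have hq0 : 0 ≤ Cq := (abs_nonneg _).trans (hCq x)
      have hp0 : 0 ≤ Cp := (abs_nonneg _).trans (hCp x)
      rw [abs_mul, abs_mul]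
      exact mul_le_mul (mul_le_mul (hCq x) (hCp x) (abs_nonneg _) hq0) (hCω x) (abs_nonneg _) (mul_nonneg hq0 hp0)
  have iC : Integrable (fun x => χ x * q x ^ 2 * ω x) μ :=
    integrable_of_measurable_abs_le μ ((hχ.mul (hq.pow_const 2)).mul hω) (C := 1 * Cq ^ 2 * Cω) fun x => by
      have hq0 : 0 ≤ Cq := (abs_nonneg _).trans (hCq x)
      have hχ1 : |χ x| ≤ 1 := by rcases hχ01 x with h | h <;> simp [h]
      rw [abs_mul, abs_mul, abs_pow]
      exact mul_le_mul (mul_le_mul hχ1 (pow_le_pow_left₀ (abs_nonneg _) (hCq x) 2) (pow_nonneg (abs_nonneg _) 2) zero_le_one) (hCω x) (abs_nonneg _)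
        (mul_nonneg zero_le_one (pow_nonneg hq0 2))
  -- the quadratic `t ↦ ∫ (t·p + χ·q)²·ω ≥ 0`
  have key : ∀ t : ℝ, 0 ≤ (∫ x, p x ^ 2 * ω x ∂μ) * (t * t) + (2 * ∫ x, q x * p x * ω x ∂μ) * t + ∫ x, χ x * q x ^ 2 * ω x ∂μ := by
    intro t
    have hpt : ∀ x, (t * p x + χ x * q x) ^ 2 * ω x = t * t * (p x ^ 2 * ω x) + 2 * t * (q x * p x * ω x) + χ x * q x ^ 2 * ω x := by
      intro x
      by_cases hx : p x = 0
      · rcases hχ01 x with h | h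
        · rw [hx, h]; ring
        · rw [hx, h]; ring
      · rw [hχp x hx]; ring
    have hnn : 0 ≤ ∫ x, (t * p x + χ x * q x) ^ 2 * ω x ∂μ := integral_nonneg fun x => mul_nonneg (sq_nonneg _) (hω0 x)
    have hsplit : ∫ x, (t * p x + χ x * q x) ^ 2 * ω x ∂μ
        = t * t * ∫ x, p x ^ 2 * ω x ∂μ + 2 * t * ∫ x, q x * p x * ω x ∂μ + ∫ x, χ x * q x ^ 2 * ω x ∂μ := by
      have iAB : Integrable (fun x => t * t * (p x ^ 2 * ω x) + 2 * t * (q x * p x * ω x)) μ := (iA.const_mul _).add (iB.const_mul _)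
      simp_rw [hpt]
      rw [integral_add iAB iC, integral_add (iA.const_mul _) (iB.const_mul _), integral_const_mul, integral_const_mul]
    rw [hsplit] at hnn
    linarith
  have hd := discrim_le_zero key
  rw [discrim] at hd
  nlinarith [hd]

variable {L : ℕ} [NeZero L]

/-- ★ **FIBREWISE CAPTURE BOUND.**  For a weight `w ≥ 0`, a fibre profile `Ω` vanishing off a measurable `S ⊆ LinkSpace L`, and a bounded measurable `f`:
`fibreInner w Ω f u ² ≤ fibreMass w Ω u · ∫ 𝟙_S(linkEmbed v)·f(orthoTube u v)²·w(orthoTube u v) dπ(v)` — the BO coefficient sees only the mass of `f` on `{relLinkVec ∈ S}`.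
[folklore] -/
theorem fibreInner_sq_le {S : Set (LinkSpace L)} (hS : MeasurableSet S) {w : GaugeConfig 3 L SU2 → ℝ} (hw : Measurable w) {Cw : ℝ} (hCw : ∀ U, |w U| ≤ Cw)
    (hw0 : ∀ U, 0 ≤ w U) {Ω : LinkSpace L → ℝ} (hΩ : Measurable Ω) {CΩ : ℝ} (hCΩ : ∀ x, |Ω x| ≤ CΩ) (hΩS : ∀ x, Ω x ≠ 0 → x ∈ S)
    {f : GaugeConfig 3 L SU2 → ℝ} (hf : Measurable f) {Cf : ℝ} (hCf : ∀ U, |f U| ≤ Cf) (u : GaugeConfig 3 1 SU2) :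
    fibreInner L w Ω f u ^ 2 ≤
      fibreMass L w Ω u * ∫ v, S.indicator (fun _ => (1 : ℝ)) (linkEmbed L v) * f (orthoTube L u v) ^ 2 * w (orthoTube L u v) ∂orthoTransverse L := by
  haveI := isFiniteMeasure_orthoTransverse L
  unfold fibreInner fibreMass
  exact sq_integral_mul_le_of_support (orthoTransverse L) (p := fun v => Ω (linkEmbed L v)) (q := fun v => f (orthoTube L u v))
    (ω := fun v => w (orthoTube L u v)) (χ := fun v => S.indicator (fun _ => (1 : ℝ)) (linkEmbed L v))
    (hΩ.comp (measurable_linkEmbed L)) (hf.comp (measurable_orthoTube_right u)) (hw.comp (measurable_orthoTube_right u))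
    ((measurable_const.indicator hS).comp (measurable_linkEmbed L)) (fun v => hCΩ _) (fun v => hCf _) (fun v => hCw _) (fun v => hw0 _)
    (fun v => by by_cases h : linkEmbed L v ∈ S <;> simp [h]) (fun v hv => by simp [Set.indicator_of_mem (hΩS _ hv)])

/-- ★ **Capture ≤ mass on the support**: where the fibre mass is positive, the BO mass `fibreInner²/fibreMass` extracted from `f` in the fibre over `u` is at most the
`w`-mass of `f` on `{relLinkVec ∈ S}` in that fibre. [folklore] -/
theorem fibre_capture_le {S : Set (LinkSpace L)} (hS : MeasurableSet S) {w : GaugeConfig 3 L SU2 → ℝ} (hw : Measurable w) {Cw : ℝ} (hCw : ∀ U, |w U| ≤ Cw)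
    (hw0 : ∀ U, 0 ≤ w U) {Ω : LinkSpace L → ℝ} (hΩ : Measurable Ω) {CΩ : ℝ} (hCΩ : ∀ x, |Ω x| ≤ CΩ) (hΩS : ∀ x, Ω x ≠ 0 → x ∈ S)
    {f : GaugeConfig 3 L SU2 → ℝ} (hf : Measurable f) {Cf : ℝ} (hCf : ∀ U, |f U| ≤ Cf) {u : GaugeConfig 3 1 SU2} (hZ : 0 < fibreMass L w Ω u) :
    fibreInner L w Ω f u ^ 2 / fibreMass L w Ω u ≤
      ∫ v, S.indicator (fun _ => (1 : ℝ)) (linkEmbed L v) * f (orthoTube L u v) ^ 2 * w (orthoTube L u v) ∂orthoTransverse L := by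
  rw [div_le_iff₀ hZ, mul_comm]
  exact fibreInner_sq_le hS hw hCw hw0 hΩ hCΩ hΩS hf hCf u

/-- ★ **Ball form** (the shape of the record's support field `hΩr : Ω β x ≠ 0 → ‖x‖ ≤ r β`): a profile supported in the fibre ball `‖x‖ ≤ r` captures, in each fibre, at most
the `w`-mass of `f` on `{‖relLinkVec‖ ≤ r}`. [folklore] -/
theorem fibre_capture_le_ball {r : ℝ} {w : GaugeConfig 3 L SU2 → ℝ} (hw : Measurable w) {Cw : ℝ} (hCw : ∀ U, |w U| ≤ Cw) (hw0 : ∀ U, 0 ≤ w U)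
    {Ω : LinkSpace L → ℝ} (hΩ : Measurable Ω) {CΩ : ℝ} (hCΩ : ∀ x, |Ω x| ≤ CΩ) (hΩr : ∀ x, Ω x ≠ 0 → ‖x‖ ≤ r)
    {f : GaugeConfig 3 L SU2 → ℝ} (hf : Measurable f) {Cf : ℝ} (hCf : ∀ U, |f U| ≤ Cf) {u : GaugeConfig 3 1 SU2} (hZ : 0 < fibreMass L w Ω u) :
    fibreInner L w Ω f u ^ 2 / fibreMass L w Ω u ≤
      ∫ v, (Metric.closedBall (0 : LinkSpace L) r).indicator (fun _ => (1 : ℝ)) (linkEmbed L v) * f (orthoTube L u v) ^ 2 * w (orthoTube L u v) ∂orthoTransverse L :=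
  fibre_capture_le measurableSet_closedBall hw hCw hw0 hΩ hCΩ (fun x hx => mem_closedBall_zero_iff.mpr (hΩr x hx)) hf hCf hZ

/-! ## §3 In the record's currency: `RecordAnalyticInput.Ω` captures only the fibre ball `‖x‖ ≤ r β`; `btOmega` only `‖x‖ ≤ β^{-1/2}` -/

/-- ★★ **THE RECORD'S BO PROJECTION CAPTURES ONLY THE FIBRE BALL `‖x‖ ≤ r β`.**  For any `A : RecordAnalyticInput L s M` (p652422), any `β`, any bounded measurable
`f` and any slow point `u` with positive fibre mass, the BO mass `fibreInner²/fibreMass` that `boProj` (weight `softWeight (recordChi L s 43 M β)`, profile `A.Ω β`) extracts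
from `f` over `u` is at most the weighted mass of `f` on `{‖relLinkVec‖ ≤ A.r β}` in that fibre (fields `hΩm`, `hΩ1`, `hΩr` only).  With `hr_small` (`r β < β^{-s}/(12|Site|)`)
and §1, (B-ST) therefore REQUIRES the near-top tube states to concentrate, fibrewise, inside `‖x‖ ≤ r β` up to `o(1)` of their `w`-mass. [cite: Luscher1983, §3] -/
theorem record_capture_le_ball {s M : ℝ} (A : RecordAnalyticInput L s M) (β : ℝ) {f : GaugeConfig 3 L SU2 → ℝ} (hf : Measurable f) {Cf : ℝ}
    (hCf : ∀ U, |f U| ≤ Cf) {u : GaugeConfig 3 1 SU2} (hZ : 0 < fibreMass L (softWeight (recordChi L s 43 M β)) (A.Ω β) u) :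
    fibreInner L (softWeight (recordChi L s 43 M β)) (A.Ω β) f u ^ 2 / fibreMass L (softWeight (recordChi L s 43 M β)) (A.Ω β) u ≤
      ∫ v, (Metric.closedBall (0 : LinkSpace L) (A.r β)).indicator (fun _ => (1 : ℝ)) (linkEmbed L v) * f (orthoTube L u v) ^ 2 *
        softWeight (recordChi L s 43 M β) (orthoTube L u v) ∂orthoTransverse L := by
  obtain ⟨hwm, hwb, hw0, -⟩ := softWeight_recordChi_props (L := L) s 43 M β
  exact fibre_capture_le_ball hwm hwb hw0 (A.hΩm β) (A.hΩ1 β) (A.hΩr β) hf hCf hZ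

/-- ★★ **`btOmega` CAPTURES ONLY `‖x‖ ≤ β^{-1/2}`.**  Lane A's profile of record (p668960: `btOmega = frozenProfile L 0 btRad`, `btRad β = min (1/40) β^{-1/2}`, flat in the
physical fibre directions) extracts from any bounded measurable `f`, in each fibre and for ANY bounded weight `w ≥ 0`, at most the `w`-mass of `f` on `{‖relLinkVec‖ ≤ β^{-1/2}}`
— in the scaled fibre coordinate `y = β^{1/2}x` the unit ball, which carries `≈ 10⁻⁴` of the Mehler ground state at `L = 2` (module docstring (i)).  With §1 this is the typed
obstruction `¬ ∃ A : RecordAnalyticInput L s M, A.Ω = btOmega L` modulo the identification of the near-top tube states (Disproof.lean §AL). [cite: Luscher1983, §3] -/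
theorem btOmega_capture_le_ball (β : ℝ) {w : GaugeConfig 3 L SU2 → ℝ} (hw : Measurable w) {Cw : ℝ} (hCw : ∀ U, |w U| ≤ Cw) (hw0 : ∀ U, 0 ≤ w U)
    {f : GaugeConfig 3 L SU2 → ℝ} (hf : Measurable f) {Cf : ℝ} (hCf : ∀ U, |f U| ≤ Cf) {u : GaugeConfig 3 1 SU2} (hZ : 0 < fibreMass L w (btOmega L β) u) :
    fibreInner L w (btOmega L β) f u ^ 2 / fibreMass L w (btOmega L β) u ≤
      ∫ v, (Metric.closedBall (0 : LinkSpace L) (powScale (1 / 2) β)).indicator (fun _ => (1 : ℝ)) (linkEmbed L v) * f (orthoTube L u v) ^ 2 *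
        w (orthoTube L u v) ∂orthoTransverse L := by
  obtain ⟨hm, h1, -, hr, -⟩ := btOmega_fields (L := L)
  exact fibre_capture_le_ball hw hCw hw0 (hm β) (h1 β) (fun x hx => (hr β x hx).trans (min_le_right _ _)) hf hCf hZ

end Summit.QuantumFields.YangMills.Theorems.TwistedTraceScaling.Negative.R40

end
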